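import Literature.NumberTheory.EllipticCurves.BurungaleSkinnerTianWan2024.CyclotomicPConverseCriterionOPEN
import Literature.NumberTheory.EllipticCurves.StrictSelmerRankOneDegreeOneProofs
import Literature.NumberTheory.EllipticCurves.BSDSelmerParityDokchitserProofs
import HarnessLib

/-!
# Burungale–Skinner–Tian–Wan Prop. 12.1 (OPEN binders) in RANK form: (inj) and `corank = 1`
# discharged from `rank_ℤ E(L) = 1 ∧ #Ш(E/L)[p^∞] < ∞`

Paper of record: A. Burungale, C. Skinner, Y. Tian, X. Wan, *Zeta elements for elliptic curves and
applications*, arXiv:2409.01350v2 — an UNREFEREED PREPRINT. Typed ≠ proved ≠ endorsed. PROOFS ONLY: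
this file introduces no named fact and no definition; every theorem is a composition of the OPEN
binders of `CyclotomicPConverseCriterionOPEN` (`prop121_pConverse_of_charIdealLe_ordinary_OPEN`,
`prop121_pConverse_of_signedCharIdealLe_supersingular_OPEN` — hypotheses, NEVER theorems) with tree
THEOREMS, and carries the binder as an explicit hypothesis `h`.

WHAT IS DISCHARGED. The binders transcribe Prop. 12.1 (p. 95) with its two Selmer-side inputs as
stated in print: (inj) «the localisation `H¹_f(L,V) → ∏_{w∣p} H¹_f(L_w,V)` is an injection» (tree:
the joint strict Selmer group at the primes above `p` is finite) and «`dim_{F_λ} H¹_f(L,V) = 1`»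
(tree: `corank_{ℤ_p} Sel_{p^∞}(E/L) = 1`). The paper USES Prop. 12.1 (proof of Thm. 12.3, p. 96, tex
l.8163–8166) through: «it follows that `corank_{𝒪_λ} Sel_{λ^∞}(A_{g/L}) = 1` and `Ш(A_{g/L})[λ^∞]`
is finite. In particular, the hypothesis (inj) holds.» Both inputs are now TREE THEOREMS from
`rank_ℤ E(L) = 1` and `#Ш(E/L)[p^∞] < ∞` at an imaginary quadratic `L` with `p` split:
(inj) = `finite_strictSelmer_iInf_adicCompletion_of_mordellWeilRank_eq_one_of_ncard_primesOver_eq_two`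
(`StrictSelmerRankOneDegreeOneProofs`: Skinner 2020 §2.2 Lemma 2 at the degree-one places, via
`L_w ≅ ℚ_p` and Silverman AEC VII.6.3), and `corank = 1` = Greenberg's corank identity
`corank Sel_{p^∞} = rank + corank Ш[p^∞]` (`selmerCorank_eq_mordellWeilRank_add_holds`) with
`corank Ш[p^∞] = 0` for finite `Ш[p^∞]` (`zpCorank_eq_zero_of_finite`).

CONTENTS (all PROVED; the deep input is the binder `h`):
* `analyticRankEK_eq_one_of_prop121_ordinary_OPEN_of_mordellWeilRank_eq_one` — ordinary branch,
  rank form; `…_of_bcs_of_mordellWeilRank_eq_one` — the same with the one-sided divisibilities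
  supplied by the REFEREED Burungale–Castella–Skinner 2025 Thm. 1.1.2 (a)
  (`charIdealLePadicLFunctionRat_of_bcs`; `p ≥ 5` good ordinary, (irr_ℚ) for `E` and `E^{(d_L)}`);
* `analyticRankEK_eq_one_of_prop121_supersingular_OPEN_of_mordellWeilRank_eq_one` — `a_p = 0`.

NOT CLAIMED: Thm. 12.3 itself (over `ℚ`: needs in addition the parity argument, the
Friedberg–Hoffstein field, Kato's Thm. 14.2 for the twist and the descent of `rank`/`Ш` from `L` to
`ℚ`; not replayed here), nor anything about the binders' truth.

## References
* [BurungaleSkinnerTianWan2024] arXiv:2409.01350v2: Prop. 12.1 (p. 95; label p-converse-prop, tex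
  l.8089–8110); proof of Thm. 12.3 (p. 96, l.8160–8170).
* [Skinner2020] Ann. of Math. 191, §2.2 Lemma 2 of arXiv:1405.7294 (p. 8) — (inj) from rank one.
* [Greenberg1999LNM] LNM 1716, §1 pp. 54–57 — the corank identity.
* [BurungaleCastellaSkinner2025] arXiv:2405.00270v2 Thm. 1.1.2 (a) (REFEREED, IMRN 2025).
-/

noncomputable section

open scoped Classical

open WeierstrassCurve NumberField IsDedekindDomain Literature.NumberTheory.EllipticCurves

namespace Literature.NumberTheory.EllipticCurves.BurungaleSkinnerTianWan2024

/-- `corank_{ℤ_p} Sel_{p^∞}(E/K) = 1` from `rank_ℤ E(K) = 1` and finite `Ш(E/K)[p^∞]` (Greenberg's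
corank identity, tree theorem `selmerCorank_eq_mordellWeilRank_add_holds`, and
`zpCorank_eq_zero_of_finite`). Same content as
`selmerCorank_eq_one_of_mordellWeilRank_eq_one_of_finite` of `BSDSelmerCMPConverseRankOneProofs`,
whose import closure this leaf avoids. [folklore] -/
private theorem selmerCorank_eq_one_of_rank_one {K : Type*} [Field K] [NumberField K]
    (W : WeierstrassCurve K) [W.IsElliptic] (p : ℕ) [Fact p.Prime] (hrank : W.mordellWeilRank = 1)
    [Finite (AddCommGroup.primaryComponent W.sha p)] : W.selmerCorank p = 1 := by
  have h0 : W.shaCorank p = 0 := zpCorank_eq_zero_of_finite _ p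
  rw [W.selmerCorank_eq_mordellWeilRank_add_holds p, hrank, h0]

/-- **Prop. 12.1, ordinary branch (OPEN binder), in RANK form.** Granted the binder `h` and the two
one-sided rational cyclotomic divisibilities for `E` and `E^{(d_L)}` (`CharIdealLePadicLFunctionRat`):
for `W/ℚ` globally minimal, `p ≠ 2` good ordinary, `L = K` imaginary quadratic with `p` split,
`(d_K, N_E) = 1` and the Heegner hypothesis, `W'` a globally minimal model of `E^{(d_K)}`,
`rank_ℤ E(K) = 1 ∧ #Ш(E/K)[p^∞] < ∞ ⟹ ord_{s=1} L(E/K, s) = 1`. The binder's Selmer-side inputs are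
DISCHARGED: (inj) by `finite_strictSelmer_iInf_adicCompletion_of_mordellWeilRank_eq_one_of_ncard_primesOver_eq_two`,
`corank = 1` by the corank identity — the step «corank … = 1 and `Ш(A_{g/L})[λ^∞]` is finite. In
particular, the hypothesis (inj) holds» of the proof of Thm. 12.3. The deep input is the OPEN binder;
asserts nothing about it. [claim: BurungaleSkinnerTianWan2024, status: under-review]
[cite: BurungaleSkinnerTianWan2024, Prop. 12.1 (p. 95; OPEN binder) and proof of Thm. 12.3 (p. 96, tex l.8163–8166)]
[cite: Skinner2020, §2.2, Lemma 2 of arXiv:1405.7294 (p. 8)] -/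
theorem analyticRankEK_eq_one_of_prop121_ordinary_OPEN_of_mordellWeilRank_eq_one
    (h : prop121_pConverse_of_charIdealLe_ordinary_OPEN.{0})
    (W W' : WeierstrassCurve ℚ) [W.IsElliptic] [W.IsGloballyMinimal] [W'.IsElliptic]
    [W'.IsGloballyMinimal] (K : Type) [Field K] [NumberField K] (p : ℕ) [Fact p.Prime]
    {C : VariableChange ℚ} (hp2 : p ≠ 2) (hgood : W.HasGoodReductionAtPrime p)
    (hord : ¬ (p : ℤ) ∣ W.frobeniusTrace p) (hK : IsImaginaryQuadratic K)
    (hsplit : ((Ideal.span {(p : ℤ)}).primesOver (𝓞 K)).ncard = 2)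
    (hcop : IsCoprime (NumberField.discr K) (W.conductorNorm ℤ))
    (hH : SatisfiesHeegnerHypothesis (W.conductorNorm ℤ) K)
    (hC : C • W' = W.quadraticTwist (NumberField.discr K : ℚ))
    (hle : CharIdealLePadicLFunctionRat W p) (hle' : CharIdealLePadicLFunctionRat W' p)
    (hrank : (W.baseChange K).mordellWeilRank = 1)
    (hsha : Finite (AddCommGroup.primaryComponent (W.baseChange K).sha p)) :
    analyticRankEK W K = 1 := by
  haveI : (W.baseChange K).IsElliptic := by rw [baseChange]; infer_instance
  haveI := hsha
  exact h W W' K p C hp2 hgood hord hK hsplit hcop hH hC hle hle'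
    (finite_strictSelmer_iInf_adicCompletion_of_mordellWeilRank_eq_one_of_ncard_primesOver_eq_two
      (W.baseChange K) p hK.1 hsplit hrank)
    (selmerCorank_eq_one_of_rank_one (W.baseChange K) p hrank)

/-- **Prop. 12.1, ordinary branch (OPEN binder), in RANK form with the REFEREED Burungale–Castella–
Skinner 2025 Thm. 1.1.2 (a) supplying the cyclotomic divisibilities** — at `p ≥ 5` of good ordinary
reduction for `E` and `E^{(d_K)}`, with `E[p]` and `E^{(d_K)}[p]` irreducible (the twist's hypotheses
are automatic for `p ∤ d_K`, kept as binders): `rank_ℤ E(K) = 1 ∧ #Ш(E/K)[p^∞] < ∞ ⟹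
ord_{s=1} L(E/K, s) = 1`. No (ram), no (sur), no Heegner-point main conj., no (inj) binder. The deep
input is the OPEN binder `h`. [claim: BurungaleSkinnerTianWan2024, status: under-review]
[cite: BurungaleSkinnerTianWan2024, Prop. 12.1 (p. 95; OPEN binder) and proof of Thm. 12.3 (p. 96)]
[cite: BurungaleCastellaSkinner2025, Thm. 1.1.2 (a) (p. 2 of arXiv:2405.00270v2)] -/
theorem analyticRankEK_eq_one_of_prop121_ordinary_OPEN_of_bcs_of_mordellWeilRank_eq_one
    (h : prop121_pConverse_of_charIdealLe_ordinary_OPEN.{0})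
    (hBCS : burungale_castella_skinner_charIdeal_eq_padicLFunction)
    (W W' : WeierstrassCurve ℚ) [W.IsElliptic] [W.IsGloballyMinimal] [W'.IsElliptic]
    [W'.IsGloballyMinimal] (K : Type) [Field K] [NumberField K] (p : ℕ) [Fact p.Prime]
    {C : VariableChange ℚ} (hp : 5 ≤ p) (hgood : W.HasGoodReductionAtPrime p)
    (hord : ¬ (p : ℤ) ∣ W.frobeniusTrace p) (hirr : W.HasIrreducibleModPGaloisRep p)
    (hgood' : W'.HasGoodReductionAtPrime p) (hord' : ¬ (p : ℤ) ∣ W'.frobeniusTrace p)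
    (hirr' : W'.HasIrreducibleModPGaloisRep p) (hK : IsImaginaryQuadratic K)
    (hsplit : ((Ideal.span {(p : ℤ)}).primesOver (𝓞 K)).ncard = 2)
    (hcop : IsCoprime (NumberField.discr K) (W.conductorNorm ℤ))
    (hH : SatisfiesHeegnerHypothesis (W.conductorNorm ℤ) K)
    (hC : C • W' = W.quadraticTwist (NumberField.discr K : ℚ))
    (hrank : (W.baseChange K).mordellWeilRank = 1)
    (hsha : Finite (AddCommGroup.primaryComponent (W.baseChange K).sha p)) :
    analyticRankEK W K = 1 :=
  analyticRankEK_eq_one_of_prop121_ordinary_OPEN_of_mordellWeilRank_eq_one h W W' K p (by omega)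
    hgood hord hK hsplit hcop hH hC (charIdealLePadicLFunctionRat_of_bcs hBCS W p hp hgood hord hirr)
    (charIdealLePadicLFunctionRat_of_bcs hBCS W' p hp hgood' hord' hirr') hrank hsha

/-- **Prop. 12.1, supersingular branch `a_p = 0` (OPEN binder), in RANK form.** Granted the binder
`h` and the one-sided rational SIGNED divisibilities for `E` and `E^{(d_K)}`, both signs
(`SignedCharIdealLePadicLFunctionRat`, flag `BSTW-121-ss-bothsigns`): `rank_ℤ E(K) = 1 ∧
#Ш(E/K)[p^∞] < ∞ ⟹ ord_{s=1} L(E/K, s) = 1`, (inj) and `corank = 1` discharged as in the ordinary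
branch. The deep input is the OPEN binder. [claim: BurungaleSkinnerTianWan2024, status: under-review]
[cite: BurungaleSkinnerTianWan2024, Prop. 12.1 (p. 95; OPEN binder), Remark 12.2 (p. 96) and proof of Thm. 12.3 (p. 96)]
[cite: Skinner2020, §2.2, Lemma 2 of arXiv:1405.7294 (p. 8)] -/
theorem analyticRankEK_eq_one_of_prop121_supersingular_OPEN_of_mordellWeilRank_eq_one
    (h : prop121_pConverse_of_signedCharIdealLe_supersingular_OPEN.{0})
    (W W' : WeierstrassCurve ℚ) [W.IsElliptic] [W.IsGloballyMinimal] [W'.IsElliptic]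
    [W'.IsGloballyMinimal] (K : Type) [Field K] [NumberField K] (p : ℕ) [Fact p.Prime]
    {C : VariableChange ℚ} (hp2 : p ≠ 2) (hgood : W.HasGoodReductionAtPrime p)
    (hap : W.frobeniusTrace p = 0) (hK : IsImaginaryQuadratic K)
    (hsplit : ((Ideal.span {(p : ℤ)}).primesOver (𝓞 K)).ncard = 2)
    (hcop : IsCoprime (NumberField.discr K) (W.conductorNorm ℤ))
    (hH : SatisfiesHeegnerHypothesis (W.conductorNorm ℤ) K)
    (hC : C • W' = W.quadraticTwist (NumberField.discr K : ℚ))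
    (hle : ∀ ε : ℤˣ, SignedCharIdealLePadicLFunctionRat W p ε)
    (hle' : ∀ ε : ℤˣ, SignedCharIdealLePadicLFunctionRat W' p ε)
    (hrank : (W.baseChange K).mordellWeilRank = 1)
    (hsha : Finite (AddCommGroup.primaryComponent (W.baseChange K).sha p)) :
    analyticRankEK W K = 1 := by
  haveI : (W.baseChange K).IsElliptic := by rw [baseChange]; infer_instance
  haveI := hsha
  exact h W W' K p C hp2 hgood hap hK hsplit hcop hH hC hle hle'
    (finite_strictSelmer_iInf_adicCompletion_of_mordellWeilRank_eq_one_of_ncard_primesOver_eq_two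
      (W.baseChange K) p hK.1 hsplit hrank)
    (selmerCorank_eq_one_of_rank_one (W.baseChange K) p hrank)

end Literature.NumberTheory.EllipticCurves.BurungaleSkinnerTianWan2024

end
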